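import Summits.RiemannHypothesis.RiemannHypothesis.Theses.RuelleBand
import HarnessLib

/-!
# `ZetaWeakRecurrence` (crux stmt-RiemannHypothesis-18110, route RuelleBand) — load-bearing analysis, II: the left edge

Negative-side support file of the crux disprover (cdisprove seat, cycle 1). Dropping the LEFT-EDGE hypothesis
`r < Re z − 1/2` of WR (discs anywhere in `{Re s < 1}`) gives a FALSE statement, for an HONEST reason —
growth: left of the critical line `|ζ(σ + iτ)|` grows like `τ^{1/2−σ}`, so no shifted copy returns. The
witness sits at `σ = −1`, where everything is EXACT (no Stirling): the functional equation at `s = 2 − iτ`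
(Mathlib `riemannZeta_one_sub`), the reflection identity `|Γ(1 − iτ)|² sinh(πτ) = πτ`
(`norm_Gamma_one_sub_mul_I_sq`), `cos(π − x) = −cos x`, `cosh²(x/2) ≥ sinh(x)/2`, and
`|ζ(2 − iτ)| ≥ 2 − π²/6 > 1/3` (`third_le_norm_zeta`) give `|ζ(−1 + iτ)|² ≥ τ³/(72π³)`, so
`|ζ(−1 + iτ)| ≥ 2` for `τ ≥ 30` (`two_le_norm_zeta_neg_one_add`), against `ζ(−1) = −1/12`.
SHARP FORM NOT CLAIMED: failure for every disc meeting `{Re s < 1/2}` would need `|χ|`-growth (Stirling) and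
a min-modulus bound `max_disc |ζ(1 − s − iτ)| ≥ τ^{−o(1)}` for all large `τ`, which is RH-strength near the line.
-/


noncomputable section

open Complex Set Metric Filter Topology

namespace Summit.RiemannHypothesis.RiemannHypothesis.Theorems.ZetaWeakRecurrence.Negative

open Summit.RiemannHypothesis.RiemannHypothesis.Theses.RuelleBand

/-- EXACT reflection identity `|Γ(1 − iτ)|² sinh(πτ) = πτ` (`Γ(z)Γ(1−z) = π / sin(πz)` at
`z = iτ`, `Γ(1 − iτ) = −iτ Γ(−iτ)`, `Γ(conj z) = conj Γ(z)`). [folklore] -/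
theorem norm_Gamma_one_sub_mul_I_sq {τ : ℝ} (hτ : 0 < τ) :
    ‖Gamma (1 - τ * I)‖ ^ 2 * Real.sinh (Real.pi * τ) = Real.pi * τ := by
  set w : ℂ := τ * I with hw
  have hw0 : w ≠ 0 := mul_ne_zero (ofReal_ne_zero.2 hτ.ne') I_ne_zero
  have hsinh : 0 < Real.sinh (Real.pi * τ) := Real.sinh_pos_iff.2 (by positivity)
  -- reflection formula, in norm
  have hrefl := Complex.Gamma_mul_Gamma_one_sub w
  have hsin : Complex.sin (↑Real.pi * w) = (Real.sinh (Real.pi * τ) : ℂ) * I := by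
    rw [hw, ← mul_assoc, show (↑Real.pi * ↑τ : ℂ) = ((Real.pi * τ : ℝ) : ℂ) by push_cast; ring,
      Complex.sin_mul_I, ← Complex.ofReal_sinh]
  rw [hsin] at hrefl
  have hnorm1 : ‖Gamma w‖ * ‖Gamma (1 - w)‖ = Real.pi / Real.sinh (Real.pi * τ) := by
    rw [← norm_mul, hrefl, norm_div, norm_mul, norm_real, norm_real, norm_I, mul_one,
      Real.norm_of_nonneg Real.pi_pos.le, Real.norm_of_nonneg hsinh.le]
  -- `Γ(1 - w) = (-w) Γ(-w)` and `|Γ(-w)| = |Γ(w)|`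
  have hshift : Gamma (1 - w) = -w * Gamma (-w) := by
    rw [show (1 : ℂ) - w = -w + 1 by ring, Complex.Gamma_add_one _ (neg_ne_zero.2 hw0)]
  have hconj : (starRingEnd ℂ) w = -w := by
    rw [hw, map_mul, Complex.conj_ofReal, Complex.conj_I]; ring
  have hnormneg : ‖Gamma (-w)‖ = ‖Gamma w‖ := by
    rw [← hconj, Complex.Gamma_conj, Complex.norm_conj]
  have hnormw : ‖w‖ = τ := by
    rw [hw, norm_mul, norm_real, norm_I, mul_one, Real.norm_of_nonneg hτ.le]
  have hnorm2 : ‖Gamma (1 - w)‖ = τ * ‖Gamma w‖ := by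
    rw [hshift, norm_mul, norm_neg, hnormneg, hnormw]
  -- combine
  have hG : ‖Gamma w‖ = ‖Gamma (1 - w)‖ / τ := by
    rw [hnorm2]; field_simp
  rw [hG] at hnorm1
  field_simp at hnorm1
  rw [mul_comm Real.pi τ]
  linarith [hnorm1]

/-- On the line `Re s = 2`: `|ζ(s) − 1| ≤ ζ(2) − 1 = π²/6 − 1`. [folklore] -/
theorem norm_zeta_sub_one_le {s : ℂ} (hs : s.re = 2) :
    ‖riemannZeta s - 1‖ ≤ Real.pi ^ 2 / 6 - 1 := by
  have hs1 : 1 < s.re := by rw [hs]; norm_num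
  have hs0 : s ≠ 0 := by
    intro h; rw [h, zero_re] at hs; norm_num at hs
  rw [zeta_eq_tsum_one_div_nat_cpow hs1]
  set f : ℕ → ℂ := fun n => 1 / (n : ℂ) ^ s with hf
  have hnorm : ∀ n : ℕ, ‖f n‖ = 1 / (n : ℝ) ^ 2 := by
    intro n
    rcases Nat.eq_zero_or_pos n with rfl | hn
    · simp [hf, Complex.zero_cpow hs0]
    · rw [hf, norm_div, norm_one, Complex.norm_natCast_cpow_of_pos hn, hs, Real.rpow_two]
  have hsum2 : HasSum (fun n : ℕ => 1 / (n : ℝ) ^ 2) (Real.pi ^ 2 / 6) := hasSum_zeta_two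
  have hsummn : Summable fun n => ‖f n‖ := by
    simp_rw [hnorm]; exact hsum2.summable
  have hsumm : Summable f := hsummn.of_norm
  have hf0 : f 0 = 0 := by simp [hf, Complex.zero_cpow hs0]
  have hf1 : f 1 = 1 := by simp [hf]
  have hsplit : ∑' n, f n = f 0 + (f 1 + ∑' n, f (n + 2)) := by
    rw [hsumm.tsum_eq_zero_add, ((summable_nat_add_iff 1).2 hsumm).tsum_eq_zero_add]
  rw [hsplit, hf0, hf1, zero_add, add_sub_cancel_left]
  have htail : HasSum (fun n : ℕ => 1 / ((n + 2 : ℕ) : ℝ) ^ 2) (Real.pi ^ 2 / 6 - 1) := by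
    have := (hasSum_nat_add_iff' 2).2 hsum2
    simpa [Finset.sum_range_succ] using this
  have hnorm2 : ∀ n : ℕ, ‖f (n + 2)‖ = 1 / ((n + 2 : ℕ) : ℝ) ^ 2 := fun n => hnorm (n + 2)
  have hsummn2 : Summable fun n => ‖f (n + 2)‖ := by
    simp_rw [hnorm2]; exact htail.summable
  calc ‖∑' n, f (n + 2)‖ ≤ ∑' n, ‖f (n + 2)‖ := norm_tsum_le_tsum_norm hsummn2
    _ = Real.pi ^ 2 / 6 - 1 := by simp_rw [hnorm2]; exact htail.tsum_eq

/-- On the line `Re s = 2`: `|ζ(s)| ≥ 2 − π²/6 > 1/3`. [folklore] -/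
theorem third_le_norm_zeta {s : ℂ} (hs : s.re = 2) : 1 / 3 ≤ ‖riemannZeta s‖ := by
  have h1 := norm_zeta_sub_one_le hs
  have h2 : ‖(1 : ℂ)‖ - ‖riemannZeta s‖ ≤ ‖(1 : ℂ) - riemannZeta s‖ := norm_sub_norm_le _ _
  rw [norm_one, norm_sub_rev] at h2
  have hπ : Real.pi ^ 2 / 6 - 1 ≤ 2 / 3 := by
    have := Real.pi_lt_d2
    nlinarith [Real.pi_pos]
  linarith

/-- POLYNOMIAL GROWTH LEFT OF THE STRIP, from exact identities only (functional equation at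
`s = 2 − iτ`, `|Γ(1−iτ)|² = πτ/sinh(πτ)`, `cos(π − x) = −cos x`, `cosh²(x/2) ≥ sinh(x)/2`,
`|ζ(2 − iτ)| > 1/3`): `|ζ(−1 + iτ)|² ≥ τ³/(72π³)`, so `|ζ(−1 + iτ)| ≥ 2` for `τ ≥ 30`.
[folklore] -/
theorem two_le_norm_zeta_neg_one_add {τ : ℝ} (hτ : 30 ≤ τ) :
    2 ≤ ‖riemannZeta (-1 + τ * I)‖ := by
  have hτpos : 0 < τ := by linarith
  set s : ℂ := 2 - τ * I with hsdef
  have hsre : s.re = 2 := by simp [hsdef]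
  have hs1 : s ≠ 1 := by
    intro h; have := congrArg Complex.re h; rw [hsre, one_re] at this; norm_num at this
  have hsn : ∀ n : ℕ, s ≠ -n := by
    intro n h
    have := congrArg Complex.re h
    rw [hsre, neg_re, natCast_re] at this
    linarith [n.cast_nonneg (α := ℝ)]
  have hFE := riemannZeta_one_sub hsn hs1
  have h1s : (1 : ℂ) - s = -1 + τ * I := by rw [hsdef]; ring
  rw [h1s] at hFE
  -- the four factors
  -- (1) `|(2π)^{-s}| = (2π)^{-2}`
  have hN : ‖(2 * ↑Real.pi : ℂ) ^ (-s)‖ = 1 / (2 * Real.pi) ^ 2 := by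
    rw [show (2 * ↑Real.pi : ℂ) = ((2 * Real.pi : ℝ) : ℂ) by push_cast; ring,
      Complex.norm_cpow_eq_rpow_re_of_pos (by positivity) (-s), neg_re, hsre,
      Real.rpow_neg (by positivity), Real.rpow_two, one_div]
  -- (2) `|Γ(s)| ≥ τ |Γ(1 - iτ)|`
  set A : ℝ := ‖Gamma (1 - τ * I)‖ with hA
  have hA0 : 0 ≤ A := norm_nonneg _
  have hGamma : τ * A ≤ ‖Gamma s‖ := by
    have h10 : (1 : ℂ) - τ * I ≠ 0 := by
      intro h; have := congrArg Complex.re h; simp at this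
    have : Gamma s = (1 - τ * I) * Gamma (1 - τ * I) := by
      rw [show s = (1 - τ * I) + 1 by rw [hsdef]; ring, Complex.Gamma_add_one _ h10]
    rw [this, norm_mul]
    apply mul_le_mul_of_nonneg_right _ hA0
    have := abs_im_le_norm (1 - τ * I)
    simp at this
    rwa [abs_of_pos hτpos] at this
  -- (3) `|cos(πs/2)| = cosh(πτ/2)`
  set C : ℝ := Real.cosh (Real.pi * τ / 2) with hC
  have hC0 : 0 < C := Real.cosh_pos _
  have hcos : ‖Complex.cos (↑Real.pi * s / 2)‖ = C := by
    have : ↑Real.pi * s / 2 = ↑Real.pi - ((Real.pi * τ / 2 : ℝ) : ℂ) * I := by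
      rw [hsdef]; push_cast; ring
    rw [this, Complex.cos_pi_sub, norm_neg, Complex.cos_mul_I, ← Complex.ofReal_cosh, norm_real,
      Real.norm_of_nonneg hC0.le]
  -- (4) `|ζ(s)| ≥ 1/3`
  have hZ := third_le_norm_zeta hsre
  -- assemble the lower bound `B ≥ τ A C / (6 π²)`
  set B : ℝ := ‖riemannZeta (-1 + τ * I)‖ with hB
  have hBeq : B = 2 * (1 / (2 * Real.pi) ^ 2) * ‖Gamma s‖ * C * ‖riemannZeta s‖ := by
    rw [hB, hFE, norm_mul, norm_mul, norm_mul, norm_mul, hN, hcos]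
    norm_num
  have hlow : τ * (A * C) / (6 * Real.pi ^ 2) ≤ B := by
    rw [hBeq]
    have hπ : 0 < Real.pi := Real.pi_pos
    calc τ * (A * C) / (6 * Real.pi ^ 2)
        = 2 * (1 / (2 * Real.pi) ^ 2) * (τ * A) * C * (1 / 3) := by field_simp; ring
      _ ≤ 2 * (1 / (2 * Real.pi) ^ 2) * ‖Gamma s‖ * C * ‖riemannZeta s‖ := by
          gcongr
  -- the analytic inequality `(A C)² ≥ πτ/2`
  have hAC : Real.pi * τ / 2 ≤ (A * C) ^ 2 := by
    have hkey := norm_Gamma_one_sub_mul_I_sq hτpos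
    rw [← hA] at hkey
    have hhalf : C ^ 2 = (Real.cosh (Real.pi * τ) + 1) / 2 := by
      have h1 := Real.cosh_two_mul (Real.pi * τ / 2)
      have h2 := Real.cosh_sq (Real.pi * τ / 2)
      rw [show 2 * (Real.pi * τ / 2) = Real.pi * τ by ring] at h1
      rw [hC]; nlinarith [h1, h2]
    have hsc : Real.sinh (Real.pi * τ) ≤ Real.cosh (Real.pi * τ) := (Real.sinh_lt_cosh _).le
    have hA2 : 0 ≤ A ^ 2 := sq_nonneg _
    calc Real.pi * τ / 2 = A ^ 2 * Real.sinh (Real.pi * τ) / 2 := by rw [hkey]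
      _ ≤ A ^ 2 * ((Real.cosh (Real.pi * τ) + 1) / 2) := by nlinarith
      _ = (A * C) ^ 2 := by rw [mul_pow, hhalf]
  -- numerics: `B² ≥ τ³/(72π³) ≥ 27000/(72·64) > 4`
  have hπ3 : Real.pi ^ 3 ≤ 64 := by
    have := Real.pi_le_four
    nlinarith [Real.pi_pos]
  have hτ3 : (27000 : ℝ) ≤ τ ^ 3 := by
    have := pow_le_pow_left₀ (by norm_num) hτ 3
    norm_num at this
    linarith
  have hL0 : 0 ≤ τ * (A * C) / (6 * Real.pi ^ 2) := by positivity
  have hB2 : 4 ≤ B ^ 2 := by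
    have h1 : (τ * (A * C) / (6 * Real.pi ^ 2)) ^ 2 ≤ B ^ 2 := pow_le_pow_left₀ hL0 hlow 2
    have h2 : τ ^ 2 * (Real.pi * τ / 2) / (36 * Real.pi ^ 4) ≤
        (τ * (A * C) / (6 * Real.pi ^ 2)) ^ 2 := by
      rw [div_pow, mul_pow, show (6 * Real.pi ^ 2) ^ 2 = 36 * Real.pi ^ 4 by ring]
      gcongr
    have h3 : (4 : ℝ) ≤ τ ^ 2 * (Real.pi * τ / 2) / (36 * Real.pi ^ 4) := by
      rw [le_div_iff₀ (by positivity)]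
      have hπ : 0 < Real.pi := Real.pi_pos
      -- 4·36π⁴ ≤ τ³ π / 2  ⟸  288 π³ ≤ τ³
      have : 288 * Real.pi ^ 3 ≤ τ ^ 3 := by linarith
      nlinarith [this, hπ]
    linarith
  by_contra hlt
  push Not at hlt
  have hB0 : 0 ≤ B := norm_nonneg _
  nlinarith [hB2, hlt, hB0]

/-- `ζ(−1) = −1/12` (Mathlib's Bernoulli evaluation). [folklore] -/
theorem zeta_neg_one_eq : riemannZeta (-1) = -1 / 12 := by
  have := riemannZeta_neg_nat_eq_bernoulli 1
  simp at this
  rw [this]; norm_num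

/-- Dropping the LEFT-EDGE hypothesis `r < Re z − 1/2` of WR (discs anywhere in `{Re s < 1}`) gives a FALSE
statement — growth left of the line: witness disc `|s + 1| ≤ 1` (inside `Re s ≤ 0 < 1`), `ε = 1`, `T = 30`,
evaluated at the centre `s = −1`: `|ζ(−1+iτ)| ≥ 2 > 1 + |ζ(−1)| = 13/12` for every `τ ≥ 30`
(`two_le_norm_zeta_neg_one_add`, `zeta_neg_one_eq`). [folklore] -/
theorem zetaWeakRecurrence_false_without_leftEdge :
    ¬ ∀ (z : ℂ) (r : ℝ), 0 < r → r < 1 - z.re → ∀ ε : ℝ, 0 < ε → ∀ T : ℝ, ∃ τ : ℝ, T ≤ τ ∧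
      ∀ s ∈ Metric.closedBall z r, ‖riemannZeta (s + ↑τ * Complex.I) - riemannZeta s‖ < ε := by
  intro h
  obtain ⟨τ, hτ, hret⟩ := h (-1) 1 one_pos (by norm_num) 1 one_pos 30
  have hmem : (-1 : ℂ) ∈ closedBall (-1 : ℂ) 1 := mem_closedBall_self zero_le_one
  have hlt := hret (-1) hmem
  have hbig := two_le_norm_zeta_neg_one_add hτ
  have hval : ‖riemannZeta (-1)‖ = 1 / 12 := by
    rw [zeta_neg_one_eq]
    norm_num
  have htri := norm_sub_norm_le (riemannZeta (-1 + τ * I)) (riemannZeta (-1))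
  linarith

end Summit.RiemannHypothesis.RiemannHypothesis.Theorems.ZetaWeakRecurrence.Negative

end
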